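import Mathlib
import Summits.ResolutionOfSingularities.ResolutionOfSingularities.Theorems.WeightedInvariantLocalWeightedDropNCDirectrixCutPairLiftChart
import Summits.ResolutionOfSingularities.ResolutionOfSingularities.Theorems.WeightedInvariantLocalWeightedDropWildTerminalCalculus

/-!
# `WeightedInvariant.LocalWeightedDrop`: LINE `directrix-cut`, SNC₂ — THE x₀-LIFT (3/5): THE SHADOW — B-PERMISSIBILITY OF THE LIFTED MOVE, DIVISIBILITIES AND LETTERS AFTER THE MOVE

OURS (res-L1-w43-stub-4 g6 for the ENGINE crux `LocalWeightedDrop` stmt-ResolutionOfSingularities-8899, W′|₄ line, R₂ corner, piece LIFT of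
res-L1-w43-strat-1's `stub_pairLift` (g11 `snc2_interface_v1.lean` e57a74989d55635b); candidates, not facts; counted 0).  THE x₀-LIFT transports a
`(m+1)`-variable B-permissible decorated strategy (`TameFourTupleDrop.DBWinsTo`, res-L1-w43-lead-1 p575221) along the product structure of a pair
position `Φ^*f = u · X₀ · (X₀ + g(x₁…x_{m+1}))`: lifted moves `(Φ;Λ(Ψ), (1,w))` with `Λ(Ψ) = (X₀, rename succ ∘ Ψ)`; answers with `c₀ ≠ 0` exit by a
head drop, answers with `c₀ = 0` are pair positions over the shadow's transform, normal-crossing shadows are monomial pair positions.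

THIS FILE: the centre lies in `div g` (`f₃ ∣ gᴺ`, `f₃(0) = 0`, (P1)₃ ⇒ `w`-order of `Ψ^*g ≥ 1`); `s ∣ (Ψ^*g)∘chart₃`; at `c = 0` the quotient
vanishes at the origin; THE LIFTED MOVE IS B-PERMISSIBLE; after the move the divisibilities `f₃' ∣ g'ᴺ`, `g' ∣ b₃'^{aA+a}` and the letter
correspondence persist (`g'` = the sliced controlled transform).
-/

set_option linter.dupNamespace false

noncomputable section

namespace Summit.ResolutionOfSingularities.ResolutionOfSingularities.Theorems

namespace TameFourTupleDrop

namespace PairLift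

open MvPowerSeries Literature.AlgebraicGeometry.Resolution

variable {k : Type} [Field k]

/-! # PART 5 — the shadow data: the chart of `Ψ^*g`, and B-permissibility of the lifted move -/

section Shadow

variable {m : ℕ}

/-- **THE CENTRE LIES IN `div g`**: if the shadow's equation `f₃` divides a power of `g`, vanishes at the origin, and the move `(Ψ, w)` is
B-permissible for the shadow, then `Ψ^* g` has `w`-order `≥ 1`. -/
theorem one_le_weightedOrder_subst_of_dvd {δ₃ : Decoration k m} {Ψ : Fin (m + 1) → MvPowerSeries (Fin (m + 1)) k} {w : Fin (m + 1) → ℕ}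
    (hperm : IsBPermissible δ₃ Ψ w) (hf₃ : constantCoeff δ₃.f = 0) {g : MvPowerSeries (Fin (m + 1)) k} {N : ℕ} (hN : δ₃.f ∣ g ^ N) :
    (1 : ℕ∞) ≤ (subst Ψ g).weightedOrder w := by
  have hΨ0 := hperm.1.1
  have hΨ : HasSubst Ψ := hasSubst_of_constantCoeff_zero hΨ0
  have h1 : (1 : ℕ∞) ≤ (subst Ψ δ₃.f).weightedOrder w := by
    refine le_trans ?_ hperm.2.1
    exact one_le_order_iff_constCoeff_eq_zero.mpr (by rw [TOT2E1.constantCoeff_subst_of_constantCoeff_zero _ hΨ0, hf₃])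
  obtain ⟨h, hh⟩ := hN
  have hpow : (1 : ℕ∞) ≤ ((subst Ψ g) ^ N).weightedOrder w := by
    rw [← coe_substAlgHom hΨ, ← map_pow, coe_substAlgHom, hh, ← coe_substAlgHom hΨ, map_mul, coe_substAlgHom]
    exact le_trans (le_add_right h1) (le_weightedOrder_mul w)
  by_contra hlt
  have h0 : (subst Ψ g).weightedOrder w = 0 := by
    by_contra hne
    exact hlt (Order.one_le_iff_ne_zero.mpr hne)
  have hzero : ((subst Ψ g) ^ N).weightedOrder w = 0 := by
    rw [show (subst Ψ g) ^ N = ∏ _i ∈ Finset.range N, subst Ψ g by rw [Finset.prod_const, Finset.card_range], weightedOrder_prod,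
      Finset.sum_eq_zero fun _ _ => h0]
  rw [hzero] at hpow
  exact absurd hpow (not_le.mpr zero_lt_one)

/-- **`s` DIVIDES THE CHART TRANSFORM** of a series of `w`-order `≥ 1`. -/
theorem exists_eq_X_zero_mul_of_one_le_weightedOrder {n : ℕ} (w : Fin n → ℕ) (c : Fin n → k) (hc : ∀ i, w i = 0 → c i = 0)
    {F : MvPowerSeries (Fin n) k} (hF : (1 : ℕ∞) ≤ F.weightedOrder w) :
    ∃ Γ : MvPowerSeries (Fin (n + 1)) k, subst (CobordantChart.chart w c) F = X 0 * Γ := by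
  refine X_dvd_iff.mpr fun d hd => ?_
  rw [← Finsupp.cons_tail d, hd]
  exact CobordantChart.coeff_subst_chart_eq_zero_of_lt w c hc F (lt_of_lt_of_le (by exact_mod_cast Nat.zero_lt_one) hF) _

/-- **AT THE POINT `c = 0` THE QUOTIENT VANISHES AT THE ORIGIN**: if `F∘chart_{w,0} = s · Γ` then `Γ(0) = 0`. -/
theorem constantCoeff_eq_zero_of_chart_zero {n : ℕ} (w : Fin n → ℕ) {F : MvPowerSeries (Fin n) k} {Γ : MvPowerSeries (Fin (n + 1)) k}
    (hfac : subst (CobordantChart.chart w (fun _ => (0 : k))) F = X 0 * Γ) : constantCoeff Γ = 0 := by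
  have h := CobordantChart.coeff_cons_of_eq_X_pow_mul (F := subst (CobordantChart.chart w (fun _ => (0 : k))) F) (g := Γ) (a := 1)
    (by rw [pow_one]; exact hfac) 0 0
  rw [Finsupp.cons_zero_zero, coeff_zero_eq_constantCoeff, add_zero, CobordantChart.coeff_cons_zero_subst_chart w _ (fun _ _ => rfl)] at h
  rw [h]
  exact MonicLinearBlowup.initEval_zero_pt w one_ne_zero F

/-- The `(1, w)`-weighted order of `X 0` is at least `1`. -/
theorem one_le_weightedOrder_X_zero (w : Fin (m + 1) → ℕ) :
    (1 : ℕ∞) ≤ (X 0 : MvPowerSeries (Fin (m + 1 + 1)) k).weightedOrder (Fin.cons 1 w : Fin (m + 1 + 1) → ℕ) := by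
  refine le_weightedOrder _ fun d hd => ?_
  rw [coeff_X]
  split_ifs with h
  · subst h
    rw [Finsupp.weight_single, one_smul, Fin.cons_zero] at hd
    exact absurd hd (by exact_mod_cast Nat.lt_irrefl 1)
  · rfl

/-- The lifted weights restrict to `w` on the shadow variables. -/
theorem cons_comp_succEmb (w : Fin (m + 1) → ℕ) : ((Fin.cons 1 w : Fin (m + 1 + 1) → ℕ) ∘ ⇑(Fin.succEmb (m + 1))) = w := by
  funext j
  rw [Function.comp_apply, Fin.coe_succEmb, Fin.cons_succ]

/-- The straightened letter of a boundary component `Φ_l = w · X_{l'}` (`w(0) ≠ 0`) is `l'` (any dimension). -/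
theorem strIdx_eq_of_eq' {n : ℕ} {Φ : Fin (n + 1) → MvPowerSeries (Fin (n + 1)) k} {l l' : Fin (n + 1)} {w : MvPowerSeries (Fin (n + 1)) k}
    (hw : constantCoeff w ≠ 0) (he : Φ l = w * X l') : strIdx Φ l = l' := by
  obtain ⟨u, hu, hu'⟩ := strIdx_spec ⟨l', w, hw, he⟩
  have hunit : IsUnit u := by
    rw [MvPowerSeries.isUnit_iff_constantCoeff]
    exact Ne.isUnit hu
  symm
  refine eq_of_X_dvd_X (k := k) ((hunit.dvd_mul_left).mp ?_)
  rw [← hu', he]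
  exact dvd_mul_left _ _

/-- **THE LIFTED MOVE STRAIGHTENS THE BOUNDARY**: `(Φ;Λ(Ψ))_l = unit · X_{j'+1}` where `Φ_l = v · X_{j+1}` and `Ψ_j = u · X_{j'}`. -/
theorem liftMove_letter {Φ : Fin (m + 1 + 1) → MvPowerSeries (Fin (m + 1 + 1)) k} {Ψ : Fin (m + 1) → MvPowerSeries (Fin (m + 1)) k}
    (hΨ0 : ∀ j, constantCoeff (Ψ j) = 0) {l : Fin (m + 1 + 1)} {j j' : Fin (m + 1)} {v : MvPowerSeries (Fin (m + 1 + 1)) k}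
    {u : MvPowerSeries (Fin (m + 1)) k} (hl : Φ l = v * X j.succ) (hj : Ψ j = u * X j') :
    subst ((Fin.cons (X 0) (fun j => rename (Fin.succEmb (m + 1)) (Ψ j)) : Fin (m + 1 + 1) → MvPowerSeries (Fin (m + 1 + 1)) k)) (Φ l) =
      (subst ((Fin.cons (X 0) (fun j => rename (Fin.succEmb (m + 1)) (Ψ j)) : Fin (m + 1 + 1) → MvPowerSeries (Fin (m + 1 + 1)) k)) v *
        rename (Fin.succEmb (m + 1)) u) * X j'.succ := by
  have hΛ := hasSubst_liftFam (k := k) hΨ0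
  rw [hl, ← coe_substAlgHom hΛ, map_mul, coe_substAlgHom, subst_X hΛ, Fin.cons_succ, hj, map_mul, rename_X, mul_assoc]
  rfl

/-- **THE LIFTED MOVE IS B-PERMISSIBLE.**  From a pair position `Φ^*f = u · X₀ · (X₀ + g)` with `O = ∅`, boundary letters sent by `Φ` onto shadow
letters, and a B-permissible shadow move `(Ψ, w)` whose centre lies in `div g` (`w`-order of `Ψ^*g ≥ 1`): the move `(Φ;Λ(Ψ), (1,w))` is
B-permissible for the four-variable decoration. -/
theorem isBPermissible_liftMove {δ : Decoration k (m + 1)} (hO : δ.O = ∅) {Φ : Fin (m + 1 + 1) → MvPowerSeries (Fin (m + 1 + 1)) k}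
    (hΦ0 : ∀ l, constantCoeff (Φ l) = 0) (hΦdet : IsUnit (Matrix.det (Matrix.of fun i j => coeff (Finsupp.single j 1) (Φ i))))
    {u : MvPowerSeries (Fin (m + 1 + 1)) k} {g : MvPowerSeries (Fin (m + 1)) k} (hu : constantCoeff u ≠ 0)
    (hf : subst Φ δ.f = u * (X 0 * (X 0 + rename (Fin.succEmb (m + 1)) g)))
    {δ₃ : Decoration k m} (hE : ∀ l ∈ δ.E, ∃ (j : Fin (m + 1)) (v : MvPowerSeries (Fin (m + 1 + 1)) k),
      constantCoeff v ≠ 0 ∧ Φ l = v * X j.succ ∧ j ∈ δ₃.E)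
    {Ψ : Fin (m + 1) → MvPowerSeries (Fin (m + 1)) k} {w : Fin (m + 1) → ℕ} (hperm : IsBPermissible δ₃ Ψ w)
    (hg : (1 : ℕ∞) ≤ (subst Ψ g).weightedOrder w) :
    IsBPermissible δ (fun l => subst ((Fin.cons (X 0) (fun j => rename (Fin.succEmb (m + 1)) (Ψ j)) :
      Fin (m + 1 + 1) → MvPowerSeries (Fin (m + 1 + 1)) k)) (Φ l)) (Fin.cons 1 w : Fin (m + 1 + 1) → ℕ) := by
  obtain ⟨⟨hΨ0, hΨdet, hw, -⟩, -, -, hP3⟩ := hperm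
  have hΛ := hasSubst_liftFam (k := k) hΨ0
  have hcomp : subst (fun l => subst ((Fin.cons (X 0) (fun j => rename (Fin.succEmb (m + 1)) (Ψ j)) :
      Fin (m + 1 + 1) → MvPowerSeries (Fin (m + 1 + 1)) k)) (Φ l)) δ.f =
      subst ((Fin.cons (X 0) (fun j => rename (Fin.succEmb (m + 1)) (Ψ j)) : Fin (m + 1 + 1) → MvPowerSeries (Fin (m + 1 + 1)) k)) u *
        (X 0 * (X 0 + rename (Fin.succEmb (m + 1)) (subst Ψ g))) := by
    rw [← subst_liftFam_pair hΨ0 u g, ← hf, subst_comp_subst_apply (hasSubst_of_constantCoeff_zero hΦ0) hΛ]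
  refine ⟨isCountMove_liftMove hΦ0 hΦdet hΨ0 hΨdet hw, ?_, fun l hl => by rw [hO] at hl; simp at hl, fun l hl => ?_⟩
  · -- (P1): `ord ≤ 2 ≤ w-ord`
    rw [hcomp]
    have hR0 : coeff (Finsupp.single (0 : Fin (m + 1 + 1)) 1) (X 0 + rename (Fin.succEmb (m + 1)) (subst Ψ g) : MvPowerSeries (Fin (m + 1 + 1)) k) ≠ 0 := by
      rw [map_add, coeff_X, if_pos rfl, coeff_single_zero_rename, add_zero]
      exact one_ne_zero
    have hordR : (X 0 + rename (Fin.succEmb (m + 1)) (subst Ψ g) : MvPowerSeries (Fin (m + 1 + 1)) k).order ≤ 1 :=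
      (order_le hR0).trans (le_of_eq (by simp only [Finsupp.degree_single, Nat.cast_one]))
    have hordX : (X 0 : MvPowerSeries (Fin (m + 1 + 1)) k).order ≤ 1 :=
      (order_le (by rw [coeff_X, if_pos rfl]; exact one_ne_zero)).trans (le_of_eq (by simp only [Finsupp.degree_single, Nat.cast_one]))
    have hRw : (1 : ℕ∞) ≤ (rename (Fin.succEmb (m + 1)) (subst Ψ g) : MvPowerSeries (Fin (m + 1 + 1)) k).weightedOrder
        (Fin.cons 1 w : Fin (m + 1 + 1) → ℕ) := by
      rw [weightedOrder_rename, cons_comp_succEmb]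
      exact hg
    have hup : (subst ((Fin.cons (X 0) (fun j => rename (Fin.succEmb (m + 1)) (Ψ j)) : Fin (m + 1 + 1) → MvPowerSeries (Fin (m + 1 + 1)) k)) u *
        (X 0 * (X 0 + rename (Fin.succEmb (m + 1)) (subst Ψ g)))).order ≤ 1 + 1 := by
      rw [order_mul, order_mul, order_eq_zero_of_constantCoeff_ne_zero (by
        rw [TOT2E1.constantCoeff_subst_of_constantCoeff_zero _ (constantCoeff_liftFam hΨ0)]; exact hu), zero_add]
      exact add_le_add hordX hordR
    refine hup.trans ?_
    calc (1 : ℕ∞) + 1 ≤ (X 0 : MvPowerSeries (Fin (m + 1 + 1)) k).weightedOrder (Fin.cons 1 w : Fin (m + 1 + 1) → ℕ) +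
          (X 0 + rename (Fin.succEmb (m + 1)) (subst Ψ g) : MvPowerSeries (Fin (m + 1 + 1)) k).weightedOrder (Fin.cons 1 w : Fin (m + 1 + 1) → ℕ) :=
          add_le_add (one_le_weightedOrder_X_zero w)
            (le_trans (le_min (one_le_weightedOrder_X_zero w) hRw) (min_weightedOrder_le_add _))
      _ ≤ (X 0 * (X 0 + rename (Fin.succEmb (m + 1)) (subst Ψ g)) : MvPowerSeries (Fin (m + 1 + 1)) k).weightedOrder
          (Fin.cons 1 w : Fin (m + 1 + 1) → ℕ) := le_weightedOrder_mul _
      _ ≤ (subst ((Fin.cons (X 0) (fun j => rename (Fin.succEmb (m + 1)) (Ψ j)) : Fin (m + 1 + 1) → MvPowerSeries (Fin (m + 1 + 1)) k)) u).weightedOrder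
            (Fin.cons 1 w : Fin (m + 1 + 1) → ℕ) +
          (X 0 * (X 0 + rename (Fin.succEmb (m + 1)) (subst Ψ g)) : MvPowerSeries (Fin (m + 1 + 1)) k).weightedOrder
            (Fin.cons 1 w : Fin (m + 1 + 1) → ℕ) := le_add_self
      _ ≤ _ := le_weightedOrder_mul _
  · -- (P3): the boundary letters are straightened
    obtain ⟨j, v, hv, hlj, hjE⟩ := hE l hl
    obtain ⟨j', u₃, hu₃, hj'⟩ := hP3 j hjE
    refine ⟨j'.succ, subst ((Fin.cons (X 0) (fun j => rename (Fin.succEmb (m + 1)) (Ψ j)) :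
      Fin (m + 1 + 1) → MvPowerSeries (Fin (m + 1 + 1)) k)) v * rename (Fin.succEmb (m + 1)) u₃, ?_, liftMove_letter hΨ0 hlj hj'⟩
    rw [map_mul, TOT2E1.constantCoeff_subst_of_constantCoeff_zero _ (constantCoeff_liftFam hΨ0), constantCoeff_rename']
    exact mul_ne_zero hv hu₃

end Shadow

/-! # PART 6 — the shadow after the move: divisibilities and letters persist -/

section ShadowStep

variable {m : ℕ}

/-- `s ∤ P`, `P ∣ sᵉ · R` ⇒ `P ∣ R` (`s = X 0` is prime). -/
theorem dvd_of_dvd_X_zero_pow_mul {n : ℕ} {P R : MvPowerSeries (Fin (n + 1)) k} (hP : ¬ (X 0 : MvPowerSeries (Fin (n + 1)) k) ∣ P) :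
    ∀ (e : ℕ), P ∣ X 0 ^ e * R → P ∣ R := by
  have hp := MvPowerSeries.prime_X' k (0 : Fin (n + 1))
  intro e
  induction e generalizing R with
  | zero => intro h; rwa [pow_zero, one_mul] at h
  | succ e ih =>
    intro h
    obtain ⟨T, hT⟩ := h
    have hXT : (X 0 : MvPowerSeries (Fin (n + 1)) k) ∣ P * T := ⟨X 0 ^ e * R, by rw [← hT]; ring⟩
    rcases hp.dvd_or_dvd hXT with hXP | ⟨T', rfl⟩
    · exact absurd hXP hP
    · refine ih ⟨T', mul_left_cancel₀ hp.ne_zero ?_⟩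
      rw [← mul_assoc, ← pow_succ', hT]
      ring

/-- `s · P ∣ sⁿ · R` ⇒ `P ∣ sⁿ · R`. -/
theorem dvd_of_X_zero_mul_dvd {n : ℕ} {P R : MvPowerSeries (Fin (n + 1)) k} {e : ℕ} (h : X 0 * P ∣ X 0 ^ e * R) : P ∣ X 0 ^ e * R := by
  rcases Nat.eq_zero_or_pos e with rfl | he
  · exact dvd_trans (dvd_mul_left P (X 0)) h
  · obtain ⟨T, hT⟩ := h
    have hX : (X 0 : MvPowerSeries (Fin (n + 1)) k) ≠ 0 := (MvPowerSeries.prime_X' k (0 : Fin (n + 1))).ne_zero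
    have h' : X 0 ^ (e - 1) * R = P * T := by
      refine mul_left_cancel₀ hX ?_
      rw [← mul_assoc, ← pow_succ', Nat.sub_add_cancel he, hT, mul_assoc]
    exact dvd_trans ⟨T, h'⟩ (mul_dvd_mul_right (pow_dvd_pow _ (Nat.sub_le e 1)) R)

/-- `sᵖ · qᵃ ∣ (s · q)^{p + a}`. -/
theorem pow_mul_pow_dvd_mul_pow {R : Type} [CommRing R] (s q : R) (p a : ℕ) : s ^ p * q ^ a ∣ (s * q) ^ (p + a) :=
  ⟨s ^ a * q ^ p, by ring⟩

/-- **(D1) PERSISTS**: the sliced strict transform of the shadow's equation divides the `N`-th power of the new `g` (the sliced controlled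
transform `Γ₁|` of `Ψ^*g`, where `(Ψ^*g)∘chart = s · Γ₁`). -/
theorem strict_dvd_pow_of_dvd_pow {δ₃ : Decoration k m} {Ψ : Fin (m + 1) → MvPowerSeries (Fin (m + 1)) k} {w : Fin (m + 1) → ℕ}
    {c : Fin (m + 1) → k} (hmv : IsCountMove Ψ w) (hc : ∀ j, w j = 0 → c j = 0) (hf0 : δ₃.f ≠ 0) {g : MvPowerSeries (Fin (m + 1)) k} {N : ℕ}
    (hN : δ₃.f ∣ g ^ N) {Γ₁ : MvPowerSeries (Fin (m + 1 + 1)) k} (hfacg : subst (CobordantChart.chart w c) (subst Ψ g) = X 0 * Γ₁)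
    (i : Fin (m + 1)) : δ₃.strict Ψ w c i ∣ TupleGame.slice i Γ₁ ^ N := by
  have hΨ : HasSubst Ψ := hasSubst_of_constantCoeff_zero hmv.1
  have hch := CobordantChart.hasSubst_chart w c hc
  obtain ⟨hfac, hnd⟩ := Decoration.fChart_eq (δ := δ₃) (c := c) hmv hc hf0
  obtain ⟨h, hh⟩ := hN
  have key : satPart (δ₃.fChart Ψ w c) ∣ X 0 ^ N * Γ₁ ^ N := by
    refine ⟨X 0 ^ satExp (δ₃.fChart Ψ w c) * subst (CobordantChart.chart w c) (subst Ψ h), ?_⟩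
    calc X 0 ^ N * Γ₁ ^ N = (X 0 * Γ₁) ^ N := (mul_pow _ _ _).symm
      _ = subst (CobordantChart.chart w c) (subst Ψ (g ^ N)) := by
          rw [← hfacg, ← coe_substAlgHom hch, ← coe_substAlgHom hΨ, map_pow, map_pow]
      _ = subst (CobordantChart.chart w c) (subst Ψ δ₃.f) * subst (CobordantChart.chart w c) (subst Ψ h) := by
          rw [hh, ← coe_substAlgHom hch, ← coe_substAlgHom hΨ, map_mul, map_mul]
      _ = _ := by rw [hfac]; ring
  rw [Decoration.strict, ← slice_pow]
  unfold TupleGame.slice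
  rw [← coe_substAlgHom (CobordantChartPlaneSlice.hasSubst_slice (R := k) i)]
  exact map_dvd _ (dvd_of_dvd_X_zero_pow_mul hnd N key)

/-- **(D2) PERSISTS**: the new `g` divides a power of the new shadow germ `s · G|`. -/
theorem slice_dvd_pow_of_dvd_pow {Ψ : Fin (m + 1) → MvPowerSeries (Fin (m + 1)) k} (hΨ0 : ∀ j, constantCoeff (Ψ j) = 0)
    {w : Fin (m + 1) → ℕ} {c : Fin (m + 1) → k} (hc : ∀ j, w j = 0 → c j = 0) {g b₃ : MvPowerSeries (Fin (m + 1)) k} {a : ℕ}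
    (ha : g ∣ b₃ ^ a) {Γ₁ : MvPowerSeries (Fin (m + 1 + 1)) k} (hfacg : subst (CobordantChart.chart w c) (subst Ψ g) = X 0 * Γ₁)
    {A : ℕ} {G : MvPowerSeries (Fin (m + 1 + 1)) k} (hfacb : subst (CobordantChart.chart w c) (subst Ψ b₃) = X 0 ^ A * G) (i : Fin (m + 1)) :
    TupleGame.slice i Γ₁ ∣ (X 0 * TupleGame.slice i G) ^ (a * A + a) := by
  have hΨ : HasSubst Ψ := hasSubst_of_constantCoeff_zero hΨ0
  have hch := CobordantChart.hasSubst_chart w c hc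
  obtain ⟨h, hh⟩ := ha
  have key : X 0 * Γ₁ ∣ X 0 ^ (a * A) * G ^ a := by
    refine ⟨subst (CobordantChart.chart w c) (subst Ψ h), ?_⟩
    calc X 0 ^ (a * A) * G ^ a = (X 0 ^ A * G) ^ a := by rw [mul_pow, ← pow_mul, mul_comm A a]
      _ = subst (CobordantChart.chart w c) (subst Ψ (b₃ ^ a)) := by
          rw [← hfacb, ← coe_substAlgHom hch, ← coe_substAlgHom hΨ, map_pow, map_pow]
      _ = subst (CobordantChart.chart w c) (subst Ψ g) * subst (CobordantChart.chart w c) (subst Ψ h) := by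
          rw [hh, ← coe_substAlgHom hch, ← coe_substAlgHom hΨ, map_mul, map_mul]
      _ = _ := by rw [hfacg]
  have key' := dvd_of_X_zero_mul_dvd key
  refine dvd_trans ?_ (pow_mul_pow_dvd_mul_pow (X 0) (TupleGame.slice i G) (a * A) a)
  have h2 := map_dvd (substAlgHom (CobordantChartPlaneSlice.hasSubst_slice (R := k) i)) key'
  rw [map_mul, map_pow, map_pow, coe_substAlgHom] at h2
  unfold TupleGame.slice
  rw [← WildTerminal.slice_X_zero (k := k) i]
  exact h2

/-- Substituting the transposition family is renaming by the transposition. -/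
theorem subst_X_swap {n : ℕ} (F : MvPowerSeries (Fin (n + 1 + 1)) k) :
    subst (fun l : Fin (n + 1 + 1) => (X (Equiv.swap (0 : Fin (n + 1 + 1)) 1 l) : MvPowerSeries (Fin (n + 1 + 1)) k)) F =
      rename (Equiv.swap (0 : Fin (n + 1 + 1)) 1) F :=
  (rename_eq_subst _ F).symm

/-- The transposition family is a legal coordinate change. -/
theorem isUnit_det_X_swap (n : ℕ) :
    IsUnit (Matrix.det (Matrix.of fun i j : Fin (n + 1 + 1) => coeff (Finsupp.single j 1)
      ((fun l : Fin (n + 1 + 1) => (X (Equiv.swap (0 : Fin (n + 1 + 1)) 1 l) : MvPowerSeries (Fin (n + 1 + 1)) k)) i))) :=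
  NCTransport.isUnit_det_linMat_perm (Equiv.swap (0 : Fin (n + 1 + 1)) 1)

/-- **THE LETTERS PERSIST.**  After the lifted move at the slot `i + 1` (point `(c₀, c)`, `c_i ≠ 0`), every boundary letter of the transform is
sent by the transposition `s ↔ y₀` onto `X_{j'+1}` with `j'` a boundary letter of the shadow's transform at `(c, i)`. -/
theorem letters_transform_lift {δ : Decoration k (m + 1)} {Φ : Fin (m + 1 + 1) → MvPowerSeries (Fin (m + 1 + 1)) k} {δ₃ : Decoration k m}
    (hE : ∀ l ∈ δ.E, ∃ (j : Fin (m + 1)) (v : MvPowerSeries (Fin (m + 1 + 1)) k), constantCoeff v ≠ 0 ∧ Φ l = v * X j.succ ∧ j ∈ δ₃.E)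
    {Ψ : Fin (m + 1) → MvPowerSeries (Fin (m + 1)) k} {w : Fin (m + 1) → ℕ} (hperm : IsBPermissible δ₃ Ψ w)
    {c : Fin (m + 1) → k} {i : Fin (m + 1)} (hci : c i ≠ 0) (c₀ : k) (W : Fin (m + 1 + 1) → ℕ) :
    ∀ l ∈ (δ.transform (fun l => subst ((Fin.cons (X 0) (fun j => rename (Fin.succEmb (m + 1)) (Ψ j)) :
        Fin (m + 1 + 1) → MvPowerSeries (Fin (m + 1 + 1)) k)) (Φ l)) W (Fin.cons c₀ c : Fin (m + 1 + 1) → k) i.succ).E,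
      ∃ (j' : Fin (m + 1)) (v' : MvPowerSeries (Fin (m + 1 + 1)) k), constantCoeff v' ≠ 0 ∧
        (fun l : Fin (m + 1 + 1) => (X (Equiv.swap (0 : Fin (m + 1 + 1)) 1 l) : MvPowerSeries (Fin (m + 1 + 1)) k)) l = v' * X j'.succ ∧
        j' ∈ (δ₃.transform Ψ w c i).E := by
  classical
  have hΨ0 := hperm.1.1
  intro l hl
  rw [Decoration.transform_E, Finset.mem_insert] at hl
  rcases hl with rfl | hl
  · refine ⟨0, 1, by rw [map_one]; exact one_ne_zero, ?_, by rw [Decoration.transform_E]; exact Finset.mem_insert_self _ _⟩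
    dsimp only
    rw [Equiv.swap_apply_left, one_mul, Fin.succ_zero_eq_one]
  · unfold Decoration.newLetters at hl
    rw [Finset.mem_image] at hl
    obtain ⟨l₀, hl₀, rfl⟩ := hl
    rw [Finset.mem_filter] at hl₀
    obtain ⟨hl₀E, hcl₀⟩ := hl₀
    obtain ⟨j, v, hv, hlj, hjE⟩ := hE l₀ hl₀E
    obtain ⟨j₁, u₃, hu₃, hj₁⟩ := hperm.2.2.2 j hjE
    have hidx : strIdx (fun l => subst ((Fin.cons (X 0) (fun j => rename (Fin.succEmb (m + 1)) (Ψ j)) :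
        Fin (m + 1 + 1) → MvPowerSeries (Fin (m + 1 + 1)) k)) (Φ l)) l₀ = j₁.succ :=
      strIdx_eq_of_eq' (by
        rw [map_mul, TOT2E1.constantCoeff_subst_of_constantCoeff_zero _ (constantCoeff_liftFam hΨ0), constantCoeff_rename']
        exact mul_ne_zero hv hu₃) (liftMove_letter hΨ0 hlj hj₁)
    rw [hidx, Fin.cons_succ] at hcl₀
    rw [hidx, Fin.succ_predAbove_succ]
    have hj₁i : j₁ ≠ i := fun h => hci (h ▸ hcl₀)
    have hp : Fin.predAbove i j₁.succ ≠ 0 := predAbove_succ_ne_zero hj₁i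
    have hidx₃ : strIdx Ψ j = j₁ := strIdx_eq_of_eq' hu₃ hj₁
    refine ⟨Fin.predAbove i j₁.succ, 1, by rw [map_one]; exact one_ne_zero, ?_, ?_⟩
    · dsimp only
      rw [one_mul, Equiv.swap_apply_of_ne_of_ne (Fin.succ_ne_zero _)
        (fun h => hp (Fin.succ_injective _ (h.trans Fin.succ_zero_eq_one.symm)))]
    · rw [Decoration.transform_E, Finset.mem_insert]
      right
      unfold Decoration.newLetters
      rw [Finset.mem_image]
      exact ⟨j, Finset.mem_filter.mpr ⟨hjE, by rw [hidx₃]; exact hcl₀⟩, by rw [hidx₃]⟩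

end ShadowStep

end PairLift

end TameFourTupleDrop

end Summit.ResolutionOfSingularities.ResolutionOfSingularities.Theorems

end
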